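import Mathlib
import HarnessLib
import Literature.Computability.AlgebraicComplexity.PermanentMonotone
import Summits.ValiantsHypothesis.ValiantsHypothesis.Theorems.DefinabilityGapK1ConstDepthRung
import Summits.ValiantsHypothesis.ValiantsHypothesis.Theorems.DepthWindowGrowing
import Summits.ValiantsHypothesis.ValiantsHypothesis.Theorems.DepthWindowImmHardTransport

/-!
# DefinabilityGap — the depth ladder of `K1 = KIPlantedHitting`, uniform in the depth function:
# the transfer and the growing rung (support for item `stmt-ValiantsHypothesis-23547`; decomp-valiant lens 5, gen 13)

`K1 = KIPlantedHitting` (route `route-ValiantsHypothesis-DefinabilityGap`, the record's declared residual; S-implied,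
kernel `S → K1`): for every `b`, infinitely often, the KI-planted permanent map `G_m = kiPer m` hits every nonzero
`D` of fan-in-two complexity and degree `≤ q(m)^b`.  Generation 12 opened the DEPTH axis of `K1` and proved its
constant-depth rung `K1cd` (`DefinabilityGapK1ConstDepthRung`).  This file makes the axis a LADDER indexed by a depth
FUNCTION `δ : ℕ → ℕ` — `K1pd(δ)`: `K1` for annihilators computed in product-depth `≤ δ m` with `≤ q^b` wires and
degree `≤ q^b` (statements spelled out; no `Prop` definitions vendored) — and climbs it to unbounded depth.  The
companion file `DefinabilityGapK1DepthLadderTop` proves `K1 ⟹ K1pd(δ)` for every `δ` (S-certificate of every rung)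
and that the ladder saturates: `K1 ⟺ K1pd(⌈log₂ q^b⌉)` (VSBR).

§1 TRANSFER, uniform in `δ` (`k1AtDepth_of_factorClosure_of_perHard`): factor closure from product-depth `δ n + 1`
   to `δ' n` with ONE wire exponent `a`, plus ROBUST infinitely-often hardness of the permanent against
   product-depth-`δ' n` polynomial-wire circuits, give `K1pd(δ)` — one proof (KI Lemma 30 in (product-depth, wires)
   currency, g12's `exists_cd_circuit_perPoly`) for the whole ladder; g12's rung is the instance `δ ≡ Δ` (`example`).
§2 GROWING RUNG (`k1AtDepth_log3_of_uniformFactorClosure`, endpoint `k1AtDepth_log3_18_25_of_uniformFactorClosure`):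
   `K1pd(⌊σ log₂log₂log₂ m⌋)` for every slope `σ = p/q ≤ 18/25`, PROVED up to ONE named print fact used as a
   hypothesis — factor closure with an ABSOLUTE additive product-depth constant `c₀` and an ABSOLUTE wire exponent
   `a` (`hfac`).  This is the uniform reading of Bhattacharjee–Kumar–Rai–Ramanathan–Saptharishi–Saraf 2025, Thm. 1 /
   Thm. 29 ("size `poly(s,d,n)`, depth `Δ + O(1)`"): the post-processing placed on top of the input circuit —
   truncated power-series roots (Thm. 27, via interpolation/homogenisation) and depth-`O(1)` symmetric functions of
   roots (Lemma 28, Andrews–Wigderson) — has absolute constant depth and polynomial size, so neither the `O(1)` nor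
   the polynomial depends on `Δ`; in (product-depth, wires) currency (merging sum chains: wires `≤ e²`, depth
   `2Δ + 1`) the constants stay absolute.  Should a referee insist on `Δ`-dependent constants, §1 still applies with
   `δ' = Δ'(δ + 1)` and the rung sits wherever `per` is hard at depth `δ'`; g12's non-uniform `CDFactorClosure` is the
   constant case.  The hardness input is lens 4's PROVED inhomogeneous `IMM` hardness
   `DepthWindow.immHardAt_of_le_18_25` (Bhargav–Dutta–Saxena slope `36/25`, halved by homogenisation;
   Limaye–Srinivasan–Tavenas), transported here to the permanent in the ROBUST quantifier shape the transfer consumes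
   (`perHard_io_log3`: `∀ K c m₀ ∃ n ≥ m₀`, every product-depth-`(⌊σ L₃ n⌋ + K)` circuit for `per_n` has `> n^c + c`
   wires; VNP-completeness projection, padding `isProjection_perPoly_of_le`, tower bookkeeping `L₃ n ≤ L₃ m + 1`).

Net picture (a theorem-backed sentence for the record, not a new node): the depth ladder of `K1` IS lens 4's depth
window in hitting-set currency — bottom `⌊0.72 L₃ m⌋` proved here modulo the named 2025 fact, top `O(log m)`
equivalent to `K1` (companion file); climbing it is exactly proving `per` hard at larger product-depth: lineages 4
and 5 share one wall.  Honest framing: rungs are S-implied slices of `K1`; `VP ≠ VNP` untouched; no new items.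
Remark (hygiene): lens 4's dial forms `DepthWindow.perHardGrowingDepth` / `perHardGrowingDepth_lst`
(`¬ ∃ c ∀ n ∃ C, pdepth C ≤ ⌊L₃ n / 3⌋ ∧ …`) are already witnessed at `n = 2` (budget `⌊L₃ 2 / 3⌋ = 0`; a
product-free circuit computes only affine polynomials, `deg per_2 = 2`); the robust shape of `perHard_io_log3`
(`∀ m₀ ∃ n ≥ m₀`, any slack `K`) is the one that carries content to consumers.

References: [KabanetsImpagliazzo2003] Lemma 30, Thm. 7.7; [BhattacharjeeEtAl2025] Thm. 1 (p. 3), Thm. 27, Lemma 28,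
Thm. 29 (p. 12), Thm. 37 (p. 17); [BhargavDuttaSaxena2024] Thm. 1.4, Rem. 1.5; [LimayeSrinivasanTavenas2025] Cor. 4,
Lemma 11; [Valiant1979].
-/

set_option linter.dupNamespace false

noncomputable section

open MvPolynomial
open Literature.Computability.AlgebraicComplexity Literature.Computability.MetaComplexity
open Summit.ValiantsHypothesis.ValiantsHypothesis.Theorems.DefinabilityGapAffineRung (qOf qOf_spec sq_le_qOf kiPer)
open Summit.ValiantsHypothesis.ValiantsHypothesis.Theorems.DepthWindow
  (exists_circuit_of_isProjection log3_tower log3_le_of_le_tower_pow ImmHardAt immHardAt_of_le_18_25)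
open Summit.ValiantsHypothesis.ValiantsHypothesis.Theorems.DefinabilityGapK1ConstDepthRung
  (exists_cd_circuit_perPoly exists_poly_le_pow_add perHard_io qOf_le_four_mul_sq)

namespace Summit.ValiantsHypothesis.ValiantsHypothesis.Theorems.DefinabilityGapK1DepthLadder

/-! ## §1 The transfer, uniform in the depth function -/

/-- The polynomial base of the wire bound produced by `exists_cd_circuit_perPoly` under the `K1` budget `q^b`:
`wires Γ + q³(m+1)³ + deg D · max 1 m + (q+1) + 2 ≤ (2·4^b + 71)(m+1)^{2b+9}`. [folklore] -/
theorem kiBase_le {b n e d : ℕ} (hCe : e ≤ qOf n ^ b) (hdeg : d ≤ qOf n ^ b) :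
    e + qOf n ^ 3 * ((n + 1) ^ 2 * (n + 1)) + d * max 1 n + (qOf n + 1) + 2 ≤
      (2 * 4 ^ b + 71) * (n + 1) ^ (2 * b + 9) := by
  have hX : 0 < n + 1 := Nat.succ_pos n
  have hq : qOf n ≤ 4 * (n + 1) ^ 2 := qOf_le_four_mul_sq n
  have hmono : ∀ i j : ℕ, i ≤ j → (n + 1) ^ i ≤ (n + 1) ^ j := fun i j h => Nat.pow_le_pow_right hX h
  have hqb : qOf n ^ b ≤ 4 ^ b * (n + 1) ^ (2 * b) := by
    calc qOf n ^ b ≤ (4 * (n + 1) ^ 2) ^ b := Nat.pow_le_pow_left hq b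
      _ = 4 ^ b * (n + 1) ^ (2 * b) := by rw [mul_pow, ← pow_mul]
  have t1 : e ≤ 4 ^ b * (n + 1) ^ (2 * b + 9) :=
    hCe.trans (hqb.trans (Nat.mul_le_mul_left _ (hmono _ _ (by omega))))
  have t2 : qOf n ^ 3 * ((n + 1) ^ 2 * (n + 1)) ≤ 64 * (n + 1) ^ (2 * b + 9) := by
    calc qOf n ^ 3 * ((n + 1) ^ 2 * (n + 1)) ≤ (4 * (n + 1) ^ 2) ^ 3 * ((n + 1) ^ 2 * (n + 1)) :=
          Nat.mul_le_mul_right _ (Nat.pow_le_pow_left hq 3)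
      _ = 64 * (n + 1) ^ 9 := by ring
      _ ≤ 64 * (n + 1) ^ (2 * b + 9) := Nat.mul_le_mul_left _ (hmono _ _ (by omega))
  have t3 : d * max 1 n ≤ 4 ^ b * (n + 1) ^ (2 * b + 9) := by
    calc d * max 1 n ≤ (4 ^ b * (n + 1) ^ (2 * b)) * (n + 1) :=
          Nat.mul_le_mul (hdeg.trans hqb) (max_le (by omega) (by omega))
      _ = 4 ^ b * (n + 1) ^ (2 * b + 1) := by rw [mul_assoc, ← pow_succ]
      _ ≤ 4 ^ b * (n + 1) ^ (2 * b + 9) := Nat.mul_le_mul_left _ (hmono _ _ (by omega))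
  have t4 : qOf n + 1 + 2 ≤ 7 * (n + 1) ^ (2 * b + 9) := by
    have h1 : 1 ≤ (n + 1) ^ 2 := Nat.one_le_pow _ _ hX
    calc qOf n + 1 + 2 ≤ 7 * (n + 1) ^ 2 := by omega
      _ ≤ 7 * (n + 1) ^ (2 * b + 9) := Nat.mul_le_mul_left _ (hmono _ _ (by omega))
  have heq : 4 ^ b * (n + 1) ^ (2 * b + 9) + 64 * (n + 1) ^ (2 * b + 9) + 4 ^ b * (n + 1) ^ (2 * b + 9) +
      7 * (n + 1) ^ (2 * b + 9) = (2 * 4 ^ b + 71) * (n + 1) ^ (2 * b + 9) := by ring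
  omega

/-- **THE TRANSFER, UNIFORM IN THE DEPTH FUNCTION** (kernel): for depth functions `δ δ' : ℕ → ℕ` and an exponent `a`,
IF constant-depth factor closure holds from product-depth `δ n + 1` to product-depth `δ' n` with wire exponent `a`
(hypothesis `hfac`, invoked only on the hybrid polynomial of the KI argument at index `n`), AND the permanent is hard
infinitely often — robustly: beyond every `m₀` — against product-depth-`δ' n` circuits with polynomially many wires
(hypothesis `hA`), THEN `K1` holds for annihilators of product-depth `≤ δ m` with `≤ q^b` wires and degree `≤ q^b`,
all `b`.  Proof = KI Lemma 30 in (product-depth, wires) currency (`exists_cd_circuit_perPoly`: hybrid argument at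
depth `+1`, Gauss, closure, un-padding projection) + the arithmetic `kiBase_le` + `hA`.  The constant rung
(`δ ≡ Δ`, g12) and the growing rung (`δ = ⌊σ L₃⌋`, below) are its two instances.
[cite: KabanetsImpagliazzo2003, Lemma 30, Thm. 7.7] [cite: BhattacharjeeEtAl2025, Thm. 1, Thm. 37] -/
theorem k1AtDepth_of_factorClosure_of_perHard {δ δ' : ℕ → ℕ} {a : ℕ}
    (hfac : ∀ (n : ℕ) (σ : Type) [Fintype σ] [DecidableEq σ] (P Q : MvPolynomial σ ℂ) (Γ : ArithCircuit ℂ σ),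
      Γ.Computes P → Γ.productDepth ≤ δ n + 1 → P ≠ 0 → Q ∣ P →
      ∃ Γ' : ArithCircuit ℂ σ, Γ'.Computes Q ∧ Γ'.productDepth ≤ δ' n ∧
        Γ'.edgeSize ≤ (Γ.edgeSize + P.totalDegree + Fintype.card σ + 2) ^ a)
    (hA : ∀ c m₀ : ℕ, ∃ n, m₀ ≤ n ∧ ∀ Γ : ArithCircuit ℂ (Fin n × Fin n),
      Γ.Computes (perPoly (Fin n) ℂ) → Γ.productDepth ≤ δ' n → n ^ c + c < Γ.edgeSize) :
    ∀ b m₀ : ℕ, ∃ m, m₀ ≤ m ∧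
      ∀ (Γ : ArithCircuit ℂ (Fin 3 → Fin (qOf m))) (D : MvPolynomial (Fin 3 → Fin (qOf m)) ℂ),
        Γ.Computes D → Γ.productDepth ≤ δ m → Γ.edgeSize ≤ qOf m ^ b → D ≠ 0 → D.totalDegree ≤ qOf m ^ b →
        bind₁ (kiPer m) D ≠ 0 := by
  classical
  intro b m₀
  obtain ⟨c, hc⟩ := exists_poly_le_pow_add ((2 * 4 ^ b + 71) ^ a) (a * (2 * b + 9))
  obtain ⟨n, hn, hhard⟩ := hA c m₀
  refine ⟨n, hn, fun Γ D hC hΔ hCe hD hdeg hann => ?_⟩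
  obtain ⟨Γ', hC'c, hC'd, hC'e⟩ :=
    exists_cd_circuit_perPoly (Δ := δ n) (Δ' := δ' n) (a := a) (hfac n) n hC hΔ hD hann
  have hlt := hhard Γ' hC'c hC'd
  have hfin : Γ'.edgeSize ≤ n ^ c + c := by
    calc Γ'.edgeSize ≤ _ := hC'e
      _ ≤ ((2 * 4 ^ b + 71) * (n + 1) ^ (2 * b + 9)) ^ a := Nat.pow_le_pow_left (kiBase_le hCe hdeg) a
      _ = (2 * 4 ^ b + 71) ^ a * (n + 1) ^ (a * (2 * b + 9)) := by
          rw [mul_pow, ← pow_mul, mul_comm (2 * b + 9) a]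
      _ ≤ n ^ c + c := hc n
  omega

/-- g12's constant-depth rung `CDFactorClosure → K1cd` is the constant instance `δ ≡ Δ`, `δ' ≡ max Δ' 1` of the
transfer, with `hA :=` lens 4's `perHard_io` (Limaye–Srinivasan–Tavenas); re-derived here as a check that the
uniform transfer subsumes it. [cite: BhattacharjeeEtAl2025, Thm. 1] [cite: LimayeSrinivasanTavenas2025, Cor. 4] -/
example
    (hfac : ∀ Δ : ℕ, ∃ Δ' a : ℕ, ∀ (σ : Type) [Fintype σ] [DecidableEq σ] (P Q : MvPolynomial σ ℂ)
      (Γ : ArithCircuit ℂ σ), Γ.Computes P → Γ.productDepth ≤ Δ → P ≠ 0 → Q ∣ P →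
      ∃ Γ' : ArithCircuit ℂ σ, Γ'.Computes Q ∧ Γ'.productDepth ≤ Δ' ∧
        Γ'.edgeSize ≤ (Γ.edgeSize + P.totalDegree + Fintype.card σ + 2) ^ a) :
    ∀ Δ b m₀ : ℕ, ∃ m, m₀ ≤ m ∧
      ∀ (Γ : ArithCircuit ℂ (Fin 3 → Fin (qOf m))) (D : MvPolynomial (Fin 3 → Fin (qOf m)) ℂ),
        Γ.Computes D → Γ.productDepth ≤ Δ → Γ.edgeSize ≤ qOf m ^ b → D ≠ 0 → D.totalDegree ≤ qOf m ^ b →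
        bind₁ (kiPer m) D ≠ 0 := by
  intro Δ b m₀
  obtain ⟨Δ', a, hfac'⟩ := hfac (Δ + 1)
  exact k1AtDepth_of_factorClosure_of_perHard (δ := fun _ => Δ) (δ' := fun _ => max Δ' 1) (a := a)
    (fun _ σ _ _ P Q Γ hC hd hP hQ => by
      obtain ⟨Γ', h1, h2, h3⟩ := hfac' σ P Q Γ hC hd hP hQ
      exact ⟨Γ', h1, h2.trans (le_max_left _ _), h3⟩)
    (fun c m₀ => perHard_io (le_max_right Δ' 1) c m₀) b m₀


/-! ## §2 The growing rung: `K1` at product-depth `⌊σ · log₂log₂log₂ m⌋`, `σ ≤ 18/25`, from UNIFORM closure -/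

/-- `p (Y+1) / q ≤ p Y / q + p + 1` (slack form of `⌊(pY+p)/q⌋ ≤ ⌊pY/q⌋ + ⌈p/q⌉`). [folklore] -/
theorem mul_succ_div_le (p Y q : ℕ) : p * (Y + 1) / q ≤ p * Y / q + p + 1 := by
  rcases Nat.eq_zero_or_pos q with rfl | hq
  · simp
  · refine Nat.div_le_of_le_mul ?_
    have h1 : p * Y < q * (p * Y / q + 1) := Nat.lt_mul_div_succ (p * Y) hq
    have h2 : p ≤ q * p := Nat.le_mul_of_pos_left p hq
    calc p * (Y + 1) = p * Y + p := by ring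
      _ ≤ q * (p * Y / q + 1) + q * p := by omega
      _ = q * (p * Y / q + p + 1) := by ring

/-- `|Fin d × Fin m × Fin m| ≤ m³ + 3` at `d = ⌊√⌊log₂ m⌋⌋`. [folklore] -/
theorem card_immVars_le (m : ℕ) :
    Fintype.card (Fin (Nat.sqrt (Nat.log 2 m)) × Fin m × Fin m) ≤ m ^ 3 + 3 := by
  simp only [Fintype.card_prod, Fintype.card_fin]
  have hd : Nat.sqrt (Nat.log 2 m) ≤ m := (Nat.sqrt_le_self _).trans (Nat.log_le_self 2 m)
  calc Nat.sqrt (Nat.log 2 m) * (m * m) ≤ m * (m * m) := Nat.mul_le_mul_right _ hd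
    _ = m ^ 3 := by ring
    _ ≤ m ^ 3 + 3 := Nat.le_add_right _ _

/-- **The permanent is hard at product-depth `⌊σ L₃ n⌋ + K`, ROBUSTLY infinitely often, for every slope
`σ = p/q ≤ 18/25`** (kernel; `L₃ = ⌊log₂⌊log₂⌊log₂ ·⌋⌋⌋`): for every `K c m₀` there is `n ≥ m₀` such that every
circuit for `per_n` of product-depth `≤ ⌊p L₃ n / q⌋ + K` has `> n^c + c` wires.  From lens 4's PROVED inhomogeneous
`IMM` hardness `immHardAt_of_le_18_25` (Bhargav–Dutta–Saxena slope `36/25` homogeneous bound, halved by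
homogenisation) transported to the permanent: `IMM_{m,⌊√log₂ m⌋}` is a projection of `per_{t m}` (VNP-completeness
over `ℂ`), hence of `per_n`, `n = max (t m) m ≥ m` (padding, `isProjection_perPoly_of_le`); projections keep
product-depth and do not increase wires; at a tower `m = 2^2^2^Y`, `L₃ n ≤ L₃ m + 1` costs depth slack `≤ p + 1`.
The ROBUST quantifier shape (`∀ m₀ ∃ n ≥ m₀`, not lens 4's dial form `¬ ∃ c ∀ n`) is what the transfer consumes.
[cite: BhargavDuttaSaxena2024, Thm. 1.4, Rem. 1.5] [cite: LimayeSrinivasanTavenas2025, Cor. 4, Lemma 11]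
[cite: Valiant1979] -/
theorem perHard_io_log3 {p q : ℕ} (hpq : 25 * p ≤ 18 * q) (K c m₀ : ℕ) :
    ∃ n, m₀ ≤ n ∧ ∀ Γ : ArithCircuit ℂ (Fin n × Fin n), Γ.Computes (perPoly (Fin n) ℂ) →
      Γ.productDepth ≤ p * Nat.log 2 (Nat.log 2 (Nat.log 2 n)) / q + K → n ^ c + c < Γ.edgeSize := by
  classical
  have hI : ImmHardAt p q := immHardAt_of_le_18_25 p q hpq
  let dd : ℕ → ℕ := fun m => Nat.sqrt (Nat.log 2 m)
  have hdd_le : ∀ m, dd m ≤ m := fun m => (Nat.sqrt_le_self _).trans (Nat.log_le_self 2 m)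
  let v : ℕ → ℕ := fun m => Fintype.card (Fin (dd m) × Fin m × Fin m)
  let e : ∀ m, (Fin (dd m) × Fin m × Fin m) ≃ Fin (v m) := fun m => Fintype.equivFin _
  let G : ∀ m, MvPolynomial (Fin (dd m) × Fin m × Fin m) ℂ := fun m => immPoly m (dd m) ℂ
  let G' : ∀ m, MvPolynomial (Fin (v m)) ℂ := fun m => renameEquiv ℂ (e m) (G m)
  have hv : ∀ m, Fintype.card (Fin (dd m) × Fin m × Fin m) ≤ m ^ 3 + 3 := card_immVars_le
  have hG : IsVPFamily G := by
    refine ⟨⟨⟨3, fun m => hv m⟩, ⟨1, fun m => ?_⟩⟩, ⟨6, fun m => ?_⟩⟩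
    · show (immPoly m (dd m) ℂ).totalDegree ≤ m ^ 1 + 1
      refine ((immPoly_isHomogeneous_holds (k := ℂ) m (dd m)).totalDegree_le).trans ?_
      rw [pow_one]; exact (hdd_le m).trans (Nat.le_succ m)
    · show complexity (immPoly m (dd m) ℂ) ≤ m ^ 6 + 6
      calc complexity (immPoly m (dd m) ℂ) ≤ m + 2 * m ^ 3 * dd m := complexity_immPoly_le ℂ m (dd m)
        _ ≤ m ^ 1 + 2 * (m ^ 1) ^ 3 * m := by
            rw [pow_one]; exact Nat.add_le_add_left (Nat.mul_le_mul_left _ (hdd_le m)) _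
        _ ≤ m ^ (3 * 1 + 3) + (3 * 1 + 3) := imm_cost_le 1 m
        _ = m ^ 6 + 6 := by norm_num
  have hG' : IsVPFamily G' := (isVPFamily_renameEquiv_iff e G).2 hG
  have hG'N : IsVNPFamily G' := IsVPFamily.isVNPFamily_holds' hG'
  obtain ⟨t, ht, hproj⟩ := (isVNPComplete_perPoly_holds ℂ ringChar_complex_ne_two).2 v G' hG'N
  obtain ⟨a, ha⟩ := ht
  -- the padded index `t' m = max (t m) m`
  obtain ⟨t', ht'⟩ : ∃ t' : ℕ → ℕ, ∀ m, t' m = max (t m) m := ⟨_, fun _ => rfl⟩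
  have ht'le : ∀ m, t' m ≤ m ^ (a + 1) + (a + 1) := fun m => by
    rw [ht']
    refine max_le ((ha m).trans ?_) ?_
    · rcases Nat.eq_zero_or_pos m with rfl | hm
      · rcases Nat.eq_zero_or_pos a with rfl | hapos
        · simp
        · rw [zero_pow hapos.ne', zero_pow (by omega)]; omega
      · exact Nat.add_le_add (Nat.pow_le_pow_right hm (Nat.le_succ a)) (Nat.le_succ a)
    · calc m = m ^ 1 := (pow_one m).symm
        _ ≤ m ^ (a + 1) := by
            rcases Nat.eq_zero_or_pos m with rfl | hm
            · simp
            · exact Nat.pow_le_pow_right hm (by omega)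
        _ ≤ m ^ (a + 1) + (a + 1) := Nat.le_add_right _ _
  obtain ⟨b, hb⟩ : IsPBounded fun m => t' m ^ c + c :=
    IsPBounded.comp_holds (s := fun N => N ^ c + c) ⟨c, fun N => le_rfl⟩ ⟨a + 1, ht'le⟩
  -- transport: a circuit for `per_{t' m}` yields one for `IMM_{m, dd m}` of no larger product-depth, gates ≤ wires
  have key : ∀ (m : ℕ) (Γ : ArithCircuit ℂ (Fin (t' m) × Fin (t' m))), Γ.Computes (perPoly (Fin (t' m)) ℂ) →
      ∃ D : ArithCircuit ℂ (Fin (dd m) × Fin m × Fin m),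
        D.Computes (G m) ∧ D.productDepth ≤ Γ.productDepth ∧ D.size ≤ Γ.edgeSize := by
    intro m Γ hΓ
    have hproj' : IsProjection (G' m) (perPoly (Fin (t' m)) ℂ) :=
      IsProjection.trans_holds (hproj m) (isProjection_perPoly_of_le ℂ (by rw [ht']; exact le_max_left _ _))
    obtain ⟨D', hD'c, hD'd, hD'e, -⟩ := exists_circuit_of_isProjection hproj' Γ hΓ
    have hGm : MvPolynomial.rename (e m).symm (G' m) = G m := by
      show MvPolynomial.rename (e m).symm (renameEquiv ℂ (e m) (G m)) = G m
      rw [renameEquiv_apply, rename_rename, (e m).symm_comp_self, rename_id_apply]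
    obtain ⟨D, hDe, hDd, hDw, hDs⟩ := ArithCircuit.exists_size_le_edgeSize (D'.rename (e m).symm)
    refine ⟨D, ?_, ?_, ?_⟩
    · rw [ArithCircuit.Computes, hDe, ← hGm]; exact hD'c.rename (e m).symm
    · exact hDd.trans ((DepthThreeChasm.productDepth_rename _ _).le.trans hD'd)
    · calc D.size ≤ D.edgeSize := hDs
        _ ≤ (D'.rename (e m).symm).edgeSize := hDw
        _ = D'.edgeSize := DepthThreeChasm.edgeSize_rename _ _
        _ ≤ Γ.edgeSize := hD'e
  -- constants: exponent / depth slack `c'`, hardness threshold `m₁`, tower point `m = 2^2^2^Y`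
  obtain ⟨m₁, hm₁⟩ := hI (b + p + K + 2)
  obtain ⟨Y, hYa, hYm⟩ : ∃ Y : ℕ, a + 2 ≤ 2 ^ Y ∧ m₀ + m₁ ≤ Y := by
    refine ⟨a + m₀ + m₁ + 2, ?_, by omega⟩
    have : a + m₀ + m₁ + 2 < 2 ^ (a + m₀ + m₁ + 2) := Nat.lt_two_pow_self
    omega
  obtain ⟨m, hm⟩ : ∃ m : ℕ, m = 2 ^ (2 ^ (2 ^ Y)) := ⟨_, rfl⟩
  have hYle : Y ≤ m := by
    have h1 : Y < 2 ^ Y := Nat.lt_two_pow_self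
    have h2 : 2 ^ Y < 2 ^ (2 ^ Y) := Nat.pow_lt_pow_right (by norm_num) h1
    have h3 : 2 ^ (2 ^ Y) < 2 ^ (2 ^ (2 ^ Y)) := Nat.pow_lt_pow_right (by norm_num) h2
    omega
  have hm1 : 1 ≤ m := hm ▸ Nat.one_le_two_pow
  have hmn : m ≤ t' m := by rw [ht']; exact le_max_right _ _
  refine ⟨t' m, by omega, fun Γ hΓ hdepth => ?_⟩
  by_contra hle
  push Not at hle
  obtain ⟨D, hDc, hDd, hDs⟩ := key m Γ hΓ
  have hL3m : Nat.log 2 (Nat.log 2 (Nat.log 2 m)) = Y := hm ▸ log3_tower Y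
  have hL3n : Nat.log 2 (Nat.log 2 (Nat.log 2 (t' m))) ≤ Y + 1 :=
    log3_le_of_le_tower_pow Y (a + 1) (t' m) hYa (hm ▸ ht'le m)
  have hdepthD : D.productDepth ≤ p * Nat.log 2 (Nat.log 2 (Nat.log 2 m)) / q + (b + p + K + 2) := by
    rw [hL3m]
    have hslack := mul_succ_div_le p Y q
    calc D.productDepth ≤ Γ.productDepth := hDd
      _ ≤ p * Nat.log 2 (Nat.log 2 (Nat.log 2 (t' m))) / q + K := hdepth
      _ ≤ p * (Y + 1) / q + K := Nat.add_le_add_right (Nat.div_le_div_right (Nat.mul_le_mul_left _ hL3n)) _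
      _ ≤ p * Y / q + (b + p + K + 2) := by omega
  have hlt := hm₁ m (by omega) D hDc hdepthD
  have hsize : D.size ≤ m ^ b + b := hDs.trans (hle.trans (hb m))
  have hmono : m ^ b + b ≤ m ^ (b + p + K + 2) + (b + p + K + 2) :=
    Nat.add_le_add (Nat.pow_le_pow_right hm1 (by omega)) (by omega)
  omega

/-- **THE GROWING RUNG OF `K1`, PROVED up to the uniform reading of the 2025 closure theorem** (first `K1` rung at
UNBOUNDED depth): if constant-depth factor closure holds with an ABSOLUTE additive depth constant `c₀` and an
ABSOLUTE wire exponent `a` (`hfac` — Bhattacharjee–Kumar–Rai–Ramanathan–Saptharishi–Saraf 2025, Thm. 1 /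
Thm. 29: a factor of a size-`s` depth-`Δ` circuit has a size-`poly(s,d,n)` depth-`(Δ + O(1))` circuit, the `O(1)`
and the polynomial coming from a fixed absolute-constant-depth post-processing — truncated Newton/Flajolet–Soria sums
and Andrews–Wigderson symmetric functions of roots — placed on top of the input circuit, hence independent of `Δ`;
typed in the tree's (product-depth, wires) currency), then for every slope `p/q ≤ 18/25` the KI-planted permanent
map `G_m` hits, for every `b` and infinitely often, every nonzero `D` of degree `≤ q(m)^b` computed in
product-depth `≤ ⌊(p/q) log₂log₂log₂ m⌋` with `≤ q(m)^b` wires.  Instance `δ = ⌊σ L₃⌋`, `δ' = δ + 1 + c₀` of the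
transfer with `hA := perHard_io_log3`.  The wall it stops at (`σ ≤ 0.72`, i.e. depth `o(log log log)`) is
lens 4's depth window verbatim: the depth axis of `K1` and the `DepthWindow` residual share one wall.
[cite: BhattacharjeeEtAl2025, Thm. 1, Thm. 29, Thm. 37] [cite: KabanetsImpagliazzo2003, Thm. 7.7]
[cite: BhargavDuttaSaxena2024, Thm. 1.4] [cite: LimayeSrinivasanTavenas2025, Cor. 4] -/
theorem k1AtDepth_log3_of_uniformFactorClosure {p q c₀ a : ℕ} (hpq : 25 * p ≤ 18 * q)
    (hfac : ∀ (Δ : ℕ) (σ : Type) [Fintype σ] [DecidableEq σ] (P Q : MvPolynomial σ ℂ) (Γ : ArithCircuit ℂ σ),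
      Γ.Computes P → Γ.productDepth ≤ Δ → P ≠ 0 → Q ∣ P →
      ∃ Γ' : ArithCircuit ℂ σ, Γ'.Computes Q ∧ Γ'.productDepth ≤ Δ + c₀ ∧
        Γ'.edgeSize ≤ (Γ.edgeSize + P.totalDegree + Fintype.card σ + 2) ^ a) :
    ∀ b m₀ : ℕ, ∃ m, m₀ ≤ m ∧
      ∀ (Γ : ArithCircuit ℂ (Fin 3 → Fin (qOf m))) (D : MvPolynomial (Fin 3 → Fin (qOf m)) ℂ),
        Γ.Computes D → Γ.productDepth ≤ p * Nat.log 2 (Nat.log 2 (Nat.log 2 m)) / q →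
        Γ.edgeSize ≤ qOf m ^ b → D ≠ 0 → D.totalDegree ≤ qOf m ^ b → bind₁ (kiPer m) D ≠ 0 :=
  k1AtDepth_of_factorClosure_of_perHard (δ := fun n => p * Nat.log 2 (Nat.log 2 (Nat.log 2 n)) / q)
    (δ' := fun n => p * Nat.log 2 (Nat.log 2 (Nat.log 2 n)) / q + 1 + c₀) (a := a)
    (fun n => hfac (p * Nat.log 2 (Nat.log 2 (Nat.log 2 n)) / q + 1))
    (fun c m₀ => by
      obtain ⟨n, hn, h⟩ := perHard_io_log3 hpq (1 + c₀) c m₀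
      exact ⟨n, hn, fun Γ hΓ hd => h Γ hΓ (hd.trans (by omega))⟩)

/-- The growing rung at the endpoint slope `18/25`: `K1` for annihilators of product-depth `≤ ⌊0.72 · log₂log₂log₂ m⌋`
and `≤ q^b` wires, from uniform factor closure. [cite: BhattacharjeeEtAl2025, Thm. 1] [cite: BhargavDuttaSaxena2024, Thm. 1.4] -/
theorem k1AtDepth_log3_18_25_of_uniformFactorClosure {c₀ a : ℕ}
    (hfac : ∀ (Δ : ℕ) (σ : Type) [Fintype σ] [DecidableEq σ] (P Q : MvPolynomial σ ℂ) (Γ : ArithCircuit ℂ σ),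
      Γ.Computes P → Γ.productDepth ≤ Δ → P ≠ 0 → Q ∣ P →
      ∃ Γ' : ArithCircuit ℂ σ, Γ'.Computes Q ∧ Γ'.productDepth ≤ Δ + c₀ ∧
        Γ'.edgeSize ≤ (Γ.edgeSize + P.totalDegree + Fintype.card σ + 2) ^ a) :
    ∀ b m₀ : ℕ, ∃ m, m₀ ≤ m ∧
      ∀ (Γ : ArithCircuit ℂ (Fin 3 → Fin (qOf m))) (D : MvPolynomial (Fin 3 → Fin (qOf m)) ℂ),
        Γ.Computes D → Γ.productDepth ≤ 18 * Nat.log 2 (Nat.log 2 (Nat.log 2 m)) / 25 →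
        Γ.edgeSize ≤ qOf m ^ b → D ≠ 0 → D.totalDegree ≤ qOf m ^ b → bind₁ (kiPer m) D ≠ 0 :=
  k1AtDepth_log3_of_uniformFactorClosure (p := 18) (q := 25) le_rfl hfac


end Summit.ValiantsHypothesis.ValiantsHypothesis.Theorems.DefinabilityGapK1DepthLadder

end
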